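import Summits.QuantumFields.YangMills.Theorems.UnitScaleTiltProp7ChartRemainderRowsPsi
import HarnessLib

/-!
# Prop 7, route-R E′, (E1-c) F4m — THE `hN` SHAPE: `ℓ²‖D*[N(ψ) − N(ψ′)](x)‖ ≤ 400(1 + |ι|)·(P + P′ + s₀)·P_d` from the gauge rows `m, ℓδ ≤ P`, `m′, ℓδ′, ρ(ψ′) ≤ P′`, `m_d, ℓδ_d, ρ(ψ−ψ′) ≤ P_d`, `ℓβ, ℓ²‖D*B‖ ≤ s₀`

Route `UnitScaleTilt`, crux K1 child «MinimiserStabilityRegPr» (`stmt-QuantumFields-19200`), cell ym3-torus, width seat px15 (gen 2); pen «px15 g2: (E1-c) GO-LOCATE» (★p1 g15,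
2026-08-28T20:45:05Z), LOCATE `LOCATE-E1C-DIVLIPSCHITZ-px15g2.md` §7 (bookkeeping (ii),(iv)).  THEOREMS ONLY (0 `def`, 0 `sorry`); `--supports stmt-QuantumFields-19200`, count-neutral.
YM₃ on T³ is a ladder rung (R3), not the Clay problem; nothing here claims the stub, the crux, d = 4 or the mass gap.

WHAT.  ✓p675771 `norm_divB_chartRemainder_sub_le_psi` bounds `ℓ²‖D*[N(ψ) − N(ψ′)](x)‖` by twelve products of rows.  Reading the rows through the (E1) gauges — `P ≥ m, ℓδ`
(= `p ψ`), `P′ ≥ ℓδ′, ρ_x(ψ′)` (= `p ψ′`; `m′` enters only through `m′ ≤ R₀`), `P_d ≥ m_d, ℓδ_d, ρ_x(ψ−ψ′)` (= `p(ψ−ψ′)`), `s₀ ≥ ℓβ, ℓ²‖D*B(x)‖` (data size), with `P, P′ ≤ ½`, `R₀ ≤ ½`, `ℓ ≥ 1` — every product is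
`≤ k·(1+|ι|)·(P + P′ + s₀)·P_d`; summing: ★★★ `norm_divB_chartRemainder_hN_shape` with the explicit constant `C_N = 400(1 + |ι|)` (generous: `e^{R₀} ≤ 2`, `e^{2R₀} ≤ 3`, `A ≤ 3`).
This is literally the `ℓ²D*`-member of `q(Nψ − Nψ′) ≤ C_N(pψ + pψ′ + s)p(ψ − ψ′)` in ✓p667460's `hN`, pointwise in `x` (the sup over `x` is the packager's one-liner).
HONEST SCOPE.  Real arithmetic ([folklore]); constants not optimised.

References: T. Bałaban, CMP 102 (1985) 277–309 [Balaban1985Variational] (Prop. 7 p.299, (141)–(143)); CMP 98 (1985) 17–51 [Balaban1985Averaging] ((19)–(21), (32)–(34)).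
-/

set_option autoImplicit false

noncomputable section

open scoped BigOperators Matrix.Norms.L2Operator Matrix
open NormedSpace

namespace Summit.QuantumFields.YangMills.Theorems.Prop7ChartRemainderHNShape

open Literature.MathematicalPhysics.QuantumFieldTheory.Balaban1983to89
open Finset
open MatrixLog (mlog)
open B9Eq39Adjoint (R covD covDstar divB)
open Summit.QuantumFields.YangMills.Theorems.Prop7ChartRemainderRowsPsi (norm_divB_chartRemainder_sub_le_psi)

variable {n : Type*} [Fintype n] [DecidableEq n] [Nonempty n]
variable {S : Type*} {ι : Type*} [Fintype ι] (T : ι → Equiv.Perm S) (U : ι → S → (Matrix n n ℂ)ˣ)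

/-- ★★★ **THE `hN` SHAPE OF THE `ℓ²D*`-MEMBER** (see the module docstring for the letters): `ℓ²‖D*[N(ψ) − N(ψ′)](x)‖ ≤ 400(1 + |ι|)·(P + P′ + s₀)·P_d`.
[cite: Balaban1985Variational, Prop. 7 p.299] [cite: Balaban1985Averaging, (19)-(21) p.21, (32)-(34) p.22] -/
theorem norm_divB_chartRemainder_hN_shape
    (hR : ∀ μ x (M : Matrix n n ℂ), ‖R (U μ x) M‖ = ‖M‖) (hRn : ∀ μ x (M : Matrix n n ℂ), ‖R (U μ x)⁻¹ M‖ = ‖M‖)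
    (hstarR : ∀ μ y (M : Matrix n n ℂ), star (R (U μ y) M) = R (U μ y) (star M))
    (hstarRinv : ∀ μ y (M : Matrix n n ℂ), R (U μ y)⁻¹ (star M) = star (R (U μ y)⁻¹ M))
    {c : ℂ} (hc : ‖c‖ ≤ 1) (ψ ψ' : S → Matrix n n ℂ)
    (hskew : ∀ y, star (c • ψ y) = -(c • ψ y)) (hskew' : ∀ y, star (c • ψ' y) = -(c • ψ' y))
    (En : ι → S → Matrix n n ℂ) (hE : ∀ μ y, ‖En μ y - 1‖ < 1) {β : ℝ} (hβ0 : 0 ≤ β) (hβ : ∀ μ y, ‖mlog (En μ y)‖ ≤ β) (hβ40 : β ≤ 1 / 40)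
    {R₀ m m' md δ δ' δd : ℝ}
    (hm : ∀ y, ‖ψ y‖ ≤ m) (hmR : m ≤ R₀) (hm' : ∀ y, ‖ψ' y‖ ≤ m') (hm'R : m' ≤ R₀) (hR₀ : R₀ ≤ 1 / 2) (hmd : ∀ y, ‖ψ y - ψ' y‖ ≤ md)
    (hδ0 : 0 ≤ δ) (hδ : ∀ μ y, ‖covD T U μ ψ y‖ ≤ δ) (hδ'0 : 0 ≤ δ') (hδ' : ∀ μ y, ‖covD T U μ ψ' y‖ ≤ δ')
    (hδd0 : 0 ≤ δd) (hδd : ∀ μ y, ‖covD T U μ (fun z => ψ z - ψ' z) y‖ ≤ δd)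
    (C : Set S) (hC : ∀ y ∈ C, ψ y = 0) (hC' : ∀ y ∈ C, ψ' y = 0)
    (d : S → ℕ) (hd : ∀ y, y ∉ C → ∃ μ, d (T μ y) + 1 ≤ d y ∨ d ((T μ).symm y) + 1 ≤ d y)
    (hs : Real.exp R₀ * Real.exp (R₀ + (δ + δ')) * (δ + δ') ≤ 1 / 2) (hK : Real.exp R₀ * (δ + δ') ≤ 1 / 80) (ℓ : ℕ) (hℓ : 1 ≤ ℓ) (x : S)
    -- the gauge readings
    {P P' Pd s₀ : ℝ} (hP : m ≤ P) (hPδ : (ℓ : ℝ) * δ ≤ P) (hP2 : P ≤ 1 / 2)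
    (hP'δ : (ℓ : ℝ) * δ' ≤ P') (hP'2 : P' ≤ 1 / 2)
    (hP'ρ : (ℓ : ℝ) * min (d x : ℝ) ℓ * ‖divB T U (fun μ y => (-c) • covD T U μ ψ' y) x‖ ≤ P')
    (hPd : md ≤ Pd) (hPdδ : (ℓ : ℝ) * δd ≤ Pd)
    (hPdρ : (ℓ : ℝ) * min (d x : ℝ) ℓ * ‖divB T U (fun μ y => (-c) • covD T U μ (fun z => ψ z - ψ' z) y) x‖ ≤ Pd)
    (hs₀β : (ℓ : ℝ) * β ≤ s₀) (hs₀div : (ℓ : ℝ) ^ 2 * ‖divB T U (fun μ y => mlog (En μ y)) x‖ ≤ s₀) :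
    (ℓ : ℝ) ^ 2 * ‖divB T U (fun μ y =>
        (mlog (exp (c • ψ y) * En μ y * star (R (U μ y) (exp (c • ψ (T μ y))))) - mlog (En μ y) + c • covD T U μ ψ y)
        - (mlog (exp (c • ψ' y) * En μ y * star (R (U μ y) (exp (c • ψ' (T μ y))))) - mlog (En μ y) + c • covD T U μ ψ' y)) x‖
      ≤ 400 * (1 + (Fintype.card ι : ℝ)) * (P + P' + s₀) * Pd := by
  have hmhalf : m ≤ 1 / 2 := hmR.trans hR₀
  have h := norm_divB_chartRemainder_sub_le_psi T U hR hRn hstarR hstarRinv hc ψ ψ' hskew hskew' En hE hβ hβ40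
    hm hmR hmhalf hm' hm'R hmd hδ0 hδ hδ'0 hδ' hδd0 hδd C hC hC' d hd hs hK ℓ x
  refine h.trans ?_
  -- nonnegativity and the numeric envelopes
  have hℓ1 : (1 : ℝ) ≤ ℓ := by exact_mod_cast hℓ
  have hℓ0 : (0 : ℝ) ≤ ℓ := by linarith only [hℓ1]
  have hm0 : 0 ≤ m := (norm_nonneg _).trans (hm x)
  have hmd0 : 0 ≤ md := (norm_nonneg _).trans (hmd x)
  have hP0 : 0 ≤ P := hm0.trans hP
  have hP'0 : 0 ≤ P' := by
    have : 0 ≤ (ℓ : ℝ) * δ' := mul_nonneg hℓ0 hδ'0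
    linarith only [this, hP'δ]
  have hPd0 : 0 ≤ Pd := hmd0.trans hPd
  have hs₀0 : 0 ≤ s₀ := by have : 0 ≤ (ℓ : ℝ) * β := mul_nonneg hℓ0 hβ0; linarith only [this, hs₀β]
  have hι0 : 0 ≤ (Fintype.card ι : ℝ) := Nat.cast_nonneg _
  have hR₀0 : 0 ≤ R₀ := hm0.trans hmR
  have hEhalf : Real.exp (1 / 2) ≤ 2 := by
    have h := Real.exp_one_lt_d9
    have h2 : Real.exp (1 / 2) * Real.exp (1 / 2) = Real.exp 1 := by rw [← Real.exp_add]; norm_num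
    nlinarith only [h, h2, Real.exp_pos (1 / 2 : ℝ)]
  have hE1 : Real.exp R₀ ≤ 2 := (Real.exp_le_exp.2 hR₀).trans hEhalf
  have hE10 : 0 ≤ Real.exp R₀ := (Real.exp_pos _).le
  have hE11 : 1 ≤ Real.exp R₀ := Real.one_le_exp hR₀0
  have hE2 : Real.exp (2 * R₀) ≤ 3 := by
    have : Real.exp (2 * R₀) ≤ Real.exp 1 := Real.exp_le_exp.2 (by linarith only [hR₀])
    linarith only [this, Real.exp_one_lt_d9]
  have hK0 : 0 ≤ δ + δ' := add_nonneg hδ0 hδ'0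
  have hK80 : δ + δ' ≤ 1 / 80 := by
    have : 1 * (δ + δ') ≤ Real.exp R₀ * (δ + δ') := mul_le_mul_of_nonneg_right hE11 hK0
    linarith only [this, hK]
  have hA : Real.exp R₀ * Real.exp (R₀ + (δ + δ')) ≤ 3 := by
    have h2 : Real.exp R₀ * Real.exp (R₀ + (δ + δ')) = Real.exp (2 * R₀ + (δ + δ')) := by rw [← Real.exp_add]; ring_nf
    have h3 : Real.exp (2 * R₀ + (δ + δ')) ≤ Real.exp (1 + 1 / 80) := Real.exp_le_exp.2 (by linarith only [hR₀, hK80])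
    have h4 : Real.exp (1 + 1 / 80) = Real.exp 1 * Real.exp (1 / 80) := by rw [← Real.exp_add]
    have h5 : Real.exp (1 / 80 : ℝ) ≤ 1 / (1 - 1 / 80) :=
      Real.exp_bound_div_one_sub_of_interval (by norm_num) (by norm_num)
    have h6 := Real.exp_one_lt_d9
    have h7 : Real.exp 1 * Real.exp (1 / 80) ≤ 2.7182818286 * (1 / (1 - 1 / 80)) :=
      mul_le_mul h6.le h5 (Real.exp_pos _).le (by norm_num)
    have h8 : (2.7182818286 : ℝ) * (1 / (1 - 1 / 80)) ≤ 3 := by norm_num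
    linarith only [h2, h3, h4, h7, h8]
  have hA0 : 0 ≤ Real.exp R₀ * Real.exp (R₀ + (δ + δ')) := by positivity
  -- scaled rows
  have ha : (ℓ : ℝ) * δ ≤ P := hPδ
  have ha' : (ℓ : ℝ) * δ' ≤ P' := hP'δ
  have had : (ℓ : ℝ) * δd ≤ Pd := hPdδ
  have hk : (ℓ : ℝ) * (δ + δ') ≤ P + P' := by rw [mul_add]; linarith only [ha, ha']
  have hPP : P + P' ≤ 1 := by linarith only [hP2, hP'2]
  have hla0 : 0 ≤ (ℓ : ℝ) * δ := mul_nonneg hℓ0 hδ0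
  have hla'0 : 0 ≤ (ℓ : ℝ) * δ' := mul_nonneg hℓ0 hδ'0
  have hlad0 : 0 ≤ (ℓ : ℝ) * δd := mul_nonneg hℓ0 hδd0
  have hlb0 : 0 ≤ (ℓ : ℝ) * β := mul_nonneg hℓ0 hβ0
  have hmd_le : md ≤ Pd := hPd
  -- T1
  have T1 : 2 * (Real.exp R₀ * md) * ((ℓ : ℝ) ^ 2 * ‖divB T U (fun μ y => mlog (En μ y)) x‖) ≤ 4 * s₀ * Pd := by
    have h1 : Real.exp R₀ * md ≤ 2 * Pd := mul_le_mul hE1 hmd_le hmd0 (by norm_num)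
    have h0 : 0 ≤ (ℓ : ℝ) ^ 2 * ‖divB T U (fun μ y => mlog (En μ y)) x‖ := by positivity
    have := mul_le_mul (mul_le_mul_of_nonneg_left h1 (by norm_num : (0:ℝ) ≤ 2)) hs₀div h0 (by positivity)
    linarith only [this]
  -- T2
  have T2 : 4 * (Fintype.card ι : ℝ) * (ℓ : ℝ) ^ 2 * ((Real.exp R₀ * (δd + 2 * δ' * md) + 4 * (Real.exp R₀ * (δ + δ')) * (Real.exp R₀ * md)) * β)
      ≤ 80 * (Fintype.card ι : ℝ) * s₀ * Pd := by
    -- ℓ²·(…)·β = (ℓβ)·[E₁(ℓδd + 2(ℓδ′)md) + 4E₁(ℓ(δ+δ′))E₁ md]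
    have e : (ℓ : ℝ) ^ 2 * ((Real.exp R₀ * (δd + 2 * δ' * md) + 4 * (Real.exp R₀ * (δ + δ')) * (Real.exp R₀ * md)) * β)
        = ((ℓ : ℝ) * β) * (Real.exp R₀ * ((ℓ : ℝ) * δd + 2 * ((ℓ : ℝ) * δ') * md) + 4 * Real.exp R₀ * ((ℓ : ℝ) * (δ + δ')) * (Real.exp R₀ * md)) := by ring
    have j1 : (ℓ : ℝ) * δ' * md ≤ P' * Pd := mul_le_mul ha' hmd_le hmd0 hP'0
    have j1' : P' * Pd ≤ 1 / 2 * Pd := mul_le_mul_of_nonneg_right hP'2 hPd0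
    have j2 : (ℓ : ℝ) * δd + 2 * ((ℓ : ℝ) * δ') * md ≤ 2 * Pd := by
      have j2a : 2 * ((ℓ : ℝ) * δ') * md = 2 * ((ℓ : ℝ) * δ' * md) := by ring
      rw [j2a]; linarith only [had, j1, j1']
    have j20 : 0 ≤ (ℓ : ℝ) * δd + 2 * ((ℓ : ℝ) * δ') * md := by positivity
    have i1 : Real.exp R₀ * ((ℓ : ℝ) * δd + 2 * ((ℓ : ℝ) * δ') * md) ≤ 2 * (2 * Pd) := mul_le_mul hE1 j2 j20 (by norm_num)
    have j3 : (ℓ : ℝ) * (δ + δ') ≤ 1 := hk.trans hPP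
    have j4 : Real.exp R₀ * ((ℓ : ℝ) * (δ + δ')) ≤ 2 * 1 := mul_le_mul hE1 j3 (mul_nonneg hℓ0 hK0) (by norm_num)
    have j5 : Real.exp R₀ * md ≤ 2 * Pd := mul_le_mul hE1 hmd_le hmd0 (by norm_num)
    have j6 : Real.exp R₀ * ((ℓ : ℝ) * (δ + δ')) * (Real.exp R₀ * md) ≤ (2 * 1) * (2 * Pd) :=
      mul_le_mul j4 j5 (by positivity) (by norm_num)
    have i3 : Real.exp R₀ * ((ℓ : ℝ) * δd + 2 * ((ℓ : ℝ) * δ') * md) + 4 * Real.exp R₀ * ((ℓ : ℝ) * (δ + δ')) * (Real.exp R₀ * md) ≤ 20 * Pd := by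
      have ea : 4 * Real.exp R₀ * ((ℓ : ℝ) * (δ + δ')) * (Real.exp R₀ * md) = 4 * (Real.exp R₀ * ((ℓ : ℝ) * (δ + δ')) * (Real.exp R₀ * md)) := by ring
      rw [ea]; linarith only [i1, j6]
    have i0 : 0 ≤ Real.exp R₀ * ((ℓ : ℝ) * δd + 2 * ((ℓ : ℝ) * δ') * md) + 4 * Real.exp R₀ * ((ℓ : ℝ) * (δ + δ')) * (Real.exp R₀ * md) := by positivity
    have i4 := mul_le_mul hs₀β i3 i0 hs₀0
    calc _ = 4 * (Fintype.card ι : ℝ) * (((ℓ : ℝ) * β) * (Real.exp R₀ * ((ℓ : ℝ) * δd + 2 * ((ℓ : ℝ) * δ') * md) + 4 * Real.exp R₀ * ((ℓ : ℝ) * (δ + δ')) * (Real.exp R₀ * md))) := by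
          rw [← e]; ring
      _ ≤ 4 * (Fintype.card ι : ℝ) * (s₀ * (20 * Pd)) := mul_le_mul_of_nonneg_left i4 (by positivity)
      _ = 80 * (Fintype.card ι : ℝ) * s₀ * Pd := by ring
  -- T3, T4
  have T3 : 2 * max ((ℓ : ℝ) * δ) m * ((ℓ : ℝ) * min (d x : ℝ) ℓ * ‖divB T U (fun μ y => (-c) • covD T U μ (fun z => ψ z - ψ' z) y) x‖) ≤ 2 * P * Pd := by
    have hmax : max ((ℓ : ℝ) * δ) m ≤ P := max_le ha hP
    have := mul_le_mul hmax hPdρ (by positivity) hP0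
    have ea : 2 * max ((ℓ : ℝ) * δ) m * ((ℓ : ℝ) * min (d x : ℝ) ℓ * ‖divB T U (fun μ y => (-c) • covD T U μ (fun z => ψ z - ψ' z) y) x‖)
        = 2 * (max ((ℓ : ℝ) * δ) m * ((ℓ : ℝ) * min (d x : ℝ) ℓ * ‖divB T U (fun μ y => (-c) • covD T U μ (fun z => ψ z - ψ' z) y) x‖)) := by ring
    rw [ea]; linarith only [this]
  have T4 : 2 * Real.exp (2 * R₀) * max ((ℓ : ℝ) * δd) md * ((ℓ : ℝ) * min (d x : ℝ) ℓ * ‖divB T U (fun μ y => (-c) • covD T U μ ψ' y) x‖) ≤ 6 * P' * Pd := by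
    have hmax : max ((ℓ : ℝ) * δd) md ≤ Pd := max_le had hPd
    have h1 := mul_le_mul hmax hP'ρ (by positivity) hPd0
    have h0 : 0 ≤ max ((ℓ : ℝ) * δd) md * ((ℓ : ℝ) * min (d x : ℝ) ℓ * ‖divB T U (fun μ y => (-c) • covD T U μ ψ' y) x‖) := by positivity
    have h2 := mul_le_mul hE2 h1 h0 (by norm_num)
    have e1 : 2 * Real.exp (2 * R₀) * max ((ℓ : ℝ) * δd) md * ((ℓ : ℝ) * min (d x : ℝ) ℓ * ‖divB T U (fun μ y => (-c) • covD T U μ ψ' y) x‖)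
        = 2 * (Real.exp (2 * R₀) * (max ((ℓ : ℝ) * δd) md * ((ℓ : ℝ) * min (d x : ℝ) ℓ * ‖divB T U (fun μ y => (-c) • covD T U μ ψ' y) x‖))) := by ring
    rw [e1]; linarith only [h2]
  -- T5
  have T5 : (Fintype.card ι : ℝ) * (ℓ : ℝ) ^ 2 * (2 * Real.exp (2 * R₀) * δ * δd + 2 * Real.exp (2 * R₀) * (δd + 4 * δ' * md) * δ')
      ≤ 18 * (Fintype.card ι : ℝ) * (P + P') * Pd := by
    have e : (ℓ : ℝ) ^ 2 * (2 * Real.exp (2 * R₀) * δ * δd + 2 * Real.exp (2 * R₀) * (δd + 4 * δ' * md) * δ')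
        = 2 * Real.exp (2 * R₀) * (((ℓ : ℝ) * δ) * ((ℓ : ℝ) * δd) + ((ℓ : ℝ) * δd) * ((ℓ : ℝ) * δ') + 4 * ((ℓ : ℝ) * δ') * ((ℓ : ℝ) * δ') * md) := by ring
    have i1 : ((ℓ : ℝ) * δ) * ((ℓ : ℝ) * δd) ≤ P * Pd := mul_le_mul ha had hlad0 hP0
    have i2 : ((ℓ : ℝ) * δd) * ((ℓ : ℝ) * δ') ≤ Pd * P' := mul_le_mul had ha' hla'0 hPd0
    have i3 : ((ℓ : ℝ) * δ') * ((ℓ : ℝ) * δ') * md ≤ P' * (1 / 2) * Pd := by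
      have := mul_le_mul (mul_le_mul ha' (ha'.trans hP'2) hla'0 hP'0) hmd_le hmd0 (by positivity)
      linarith only [this]
    have i4 : ((ℓ : ℝ) * δ) * ((ℓ : ℝ) * δd) + ((ℓ : ℝ) * δd) * ((ℓ : ℝ) * δ') + 4 * ((ℓ : ℝ) * δ') * ((ℓ : ℝ) * δ') * md ≤ (P + 3 * P') * Pd := by
      have e1 : (P + 3 * P') * Pd = P * Pd + Pd * P' + 4 * (P' * (1 / 2) * Pd) := by ring
      rw [e1]; linarith only [i1, i2, i3]
    have i0 : 0 ≤ ((ℓ : ℝ) * δ) * ((ℓ : ℝ) * δd) + ((ℓ : ℝ) * δd) * ((ℓ : ℝ) * δ') + 4 * ((ℓ : ℝ) * δ') * ((ℓ : ℝ) * δ') * md := by positivity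
    calc _ = (Fintype.card ι : ℝ) * (2 * Real.exp (2 * R₀) * (((ℓ : ℝ) * δ) * ((ℓ : ℝ) * δd) + ((ℓ : ℝ) * δd) * ((ℓ : ℝ) * δ') + 4 * ((ℓ : ℝ) * δ') * ((ℓ : ℝ) * δ') * md)) := by
          rw [← e]; ring
      _ ≤ (Fintype.card ι : ℝ) * (2 * (3 * ((P + 3 * P') * Pd))) := by
          refine mul_le_mul_of_nonneg_left ?_ hι0
          have := mul_le_mul hE2 i4 i0 (by norm_num)
          have eb : 2 * Real.exp (2 * R₀) * (((ℓ : ℝ) * δ) * ((ℓ : ℝ) * δd) + ((ℓ : ℝ) * δd) * ((ℓ : ℝ) * δ') + 4 * ((ℓ : ℝ) * δ') * ((ℓ : ℝ) * δ') * md)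
              = 2 * (Real.exp (2 * R₀) * (((ℓ : ℝ) * δ) * ((ℓ : ℝ) * δd) + ((ℓ : ℝ) * δd) * ((ℓ : ℝ) * δ') + 4 * ((ℓ : ℝ) * δ') * ((ℓ : ℝ) * δ') * md)) := by ring
          rw [eb]; linarith only [this]
      _ ≤ 18 * (Fintype.card ι : ℝ) * (P + P') * Pd := by
          have n1 := mul_nonneg hι0 (mul_nonneg hP0 hPd0)
          have e1 : (Fintype.card ι : ℝ) * (2 * (3 * ((P + 3 * P') * Pd))) = 6 * ((Fintype.card ι : ℝ) * (P * Pd)) + 18 * ((Fintype.card ι : ℝ) * (P' * Pd)) := by ring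
          have e2 : 18 * (Fintype.card ι : ℝ) * (P + P') * Pd = 18 * ((Fintype.card ι : ℝ) * (P * Pd)) + 18 * ((Fintype.card ι : ℝ) * (P' * Pd)) := by ring
          rw [e1, e2]; linarith only [n1]
  -- T6
  have T6 : 2 * (Fintype.card ι : ℝ) * (ℓ : ℝ) ^ 2 *
        ((((Real.exp R₀ * Real.exp (R₀ + (δ + δ'))) + 2 * (Real.exp R₀ * Real.exp (R₀ + (δ + δ'))) ^ 2) * (δ + δ') * δd) + ((4 / 3 * (Real.exp R₀ * Real.exp (R₀ + (δ + δ'))) + 6 * (Real.exp R₀ * Real.exp (R₀ + (δ + δ'))) ^ 2) * (δ + δ') ^ 2 * md))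
      ≤ 158 * (Fintype.card ι : ℝ) * (P + P') * Pd := by
    have e : (ℓ : ℝ) ^ 2 * ((((Real.exp R₀ * Real.exp (R₀ + (δ + δ'))) + 2 * (Real.exp R₀ * Real.exp (R₀ + (δ + δ'))) ^ 2) * (δ + δ') * δd) + ((4 / 3 * (Real.exp R₀ * Real.exp (R₀ + (δ + δ'))) + 6 * (Real.exp R₀ * Real.exp (R₀ + (δ + δ'))) ^ 2) * (δ + δ') ^ 2 * md))
        = ((Real.exp R₀ * Real.exp (R₀ + (δ + δ'))) + 2 * (Real.exp R₀ * Real.exp (R₀ + (δ + δ'))) ^ 2) * (((ℓ : ℝ) * (δ + δ')) * ((ℓ : ℝ) * δd)) + (4 / 3 * (Real.exp R₀ * Real.exp (R₀ + (δ + δ'))) + 6 * (Real.exp R₀ * Real.exp (R₀ + (δ + δ'))) ^ 2) * (((ℓ : ℝ) * (δ + δ')) * ((ℓ : ℝ) * (δ + δ')) * md) := by ring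
    have hsq : (Real.exp R₀ * Real.exp (R₀ + (δ + δ'))) ^ 2 ≤ 9 := by
      have := pow_le_pow_left₀ hA0 hA 2
      linarith only [this, show (3 : ℝ) ^ 2 = 9 by norm_num]
    have c1 : (Real.exp R₀ * Real.exp (R₀ + (δ + δ'))) + 2 * (Real.exp R₀ * Real.exp (R₀ + (δ + δ'))) ^ 2 ≤ 21 := by linarith only [hsq, hA, hA0]
    have c2 : 4 / 3 * (Real.exp R₀ * Real.exp (R₀ + (δ + δ'))) + 6 * (Real.exp R₀ * Real.exp (R₀ + (δ + δ'))) ^ 2 ≤ 58 := by linarith only [hsq, hA, hA0]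
    have hlk0 : 0 ≤ (ℓ : ℝ) * (δ + δ') := mul_nonneg hℓ0 hK0
    have i1 : ((ℓ : ℝ) * (δ + δ')) * ((ℓ : ℝ) * δd) ≤ (P + P') * Pd := mul_le_mul hk had hlad0 (add_nonneg hP0 hP'0)
    have i2 : ((ℓ : ℝ) * (δ + δ')) * ((ℓ : ℝ) * (δ + δ')) * md ≤ (P + P') * 1 * Pd :=
      mul_le_mul (mul_le_mul hk (hk.trans hPP) hlk0 (add_nonneg hP0 hP'0)) hmd_le hmd0 (by positivity)
    have i10 : 0 ≤ ((ℓ : ℝ) * (δ + δ')) * ((ℓ : ℝ) * δd) := by positivity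
    have i20 : 0 ≤ ((ℓ : ℝ) * (δ + δ')) * ((ℓ : ℝ) * (δ + δ')) * md := by positivity
    have j1 := mul_le_mul c1 i1 i10 (by norm_num)
    have j2 := mul_le_mul c2 i2 i20 (by norm_num)
    calc _ = 2 * (Fintype.card ι : ℝ) * (((Real.exp R₀ * Real.exp (R₀ + (δ + δ'))) + 2 * (Real.exp R₀ * Real.exp (R₀ + (δ + δ'))) ^ 2) * (((ℓ : ℝ) * (δ + δ')) * ((ℓ : ℝ) * δd)) + (4 / 3 * (Real.exp R₀ * Real.exp (R₀ + (δ + δ'))) + 6 * (Real.exp R₀ * Real.exp (R₀ + (δ + δ'))) ^ 2) * (((ℓ : ℝ) * (δ + δ')) * ((ℓ : ℝ) * (δ + δ')) * md)) := by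
          rw [← e]; ring
      _ ≤ 2 * (Fintype.card ι : ℝ) * (21 * ((P + P') * Pd) + 58 * ((P + P') * 1 * Pd)) := mul_le_mul_of_nonneg_left (add_le_add j1 j2) (by positivity)
      _ = 158 * (Fintype.card ι : ℝ) * (P + P') * Pd := by ring
  -- T7
  have T7 : 2 * (Fintype.card ι : ℝ) * (ℓ : ℝ) ^ 2 * (β * (24 * (Real.exp R₀ * (δ + δ')) * (Real.exp R₀ * md) + 8 * (Real.exp R₀ * (δd + 2 * δ' * md))))
      ≤ 288 * (Fintype.card ι : ℝ) * s₀ * Pd := by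
    have e : (ℓ : ℝ) ^ 2 * (β * (24 * (Real.exp R₀ * (δ + δ')) * (Real.exp R₀ * md) + 8 * (Real.exp R₀ * (δd + 2 * δ' * md))))
        = ((ℓ : ℝ) * β) * (24 * Real.exp R₀ * Real.exp R₀ * (((ℓ : ℝ) * (δ + δ')) * md) + 8 * Real.exp R₀ * ((ℓ : ℝ) * δd + 2 * ((ℓ : ℝ) * δ') * md)) := by ring
    have i1 : ((ℓ : ℝ) * (δ + δ')) * md ≤ 1 * Pd := mul_le_mul (hk.trans hPP) hmd_le hmd0 (by norm_num)
    have i2 : (ℓ : ℝ) * δd + 2 * ((ℓ : ℝ) * δ') * md ≤ Pd + 2 * (1 / 2) * Pd := by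
      have := mul_le_mul (ha'.trans hP'2) hmd_le hmd0 (by norm_num)
      have ec : 2 * ((ℓ : ℝ) * δ') * md = 2 * ((ℓ : ℝ) * δ' * md) := by ring
      rw [ec]; linarith only [had, this]
    have i3 : 24 * Real.exp R₀ * Real.exp R₀ * (((ℓ : ℝ) * (δ + δ')) * md) + 8 * Real.exp R₀ * ((ℓ : ℝ) * δd + 2 * ((ℓ : ℝ) * δ') * md) ≤ 144 * Pd := by
      have hEE : Real.exp R₀ * Real.exp R₀ ≤ 2 * 2 := mul_le_mul hE1 hE1 hE10 (by norm_num)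
      have i10 : 0 ≤ ((ℓ : ℝ) * (δ + δ')) * md := by positivity
      have i20 : 0 ≤ (ℓ : ℝ) * δd + 2 * ((ℓ : ℝ) * δ') * md := by positivity
      have k1 : Real.exp R₀ * Real.exp R₀ * (((ℓ : ℝ) * (δ + δ')) * md) ≤ (2 * 2) * (1 * Pd) := mul_le_mul hEE i1 i10 (by norm_num)
      have k2 : Real.exp R₀ * ((ℓ : ℝ) * δd + 2 * ((ℓ : ℝ) * δ') * md) ≤ 2 * (Pd + 2 * (1 / 2) * Pd) := mul_le_mul hE1 i2 i20 (by norm_num)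
      have ed : 24 * Real.exp R₀ * Real.exp R₀ * (((ℓ : ℝ) * (δ + δ')) * md) + 8 * Real.exp R₀ * ((ℓ : ℝ) * δd + 2 * ((ℓ : ℝ) * δ') * md)
          = 24 * (Real.exp R₀ * Real.exp R₀ * (((ℓ : ℝ) * (δ + δ')) * md)) + 8 * (Real.exp R₀ * ((ℓ : ℝ) * δd + 2 * ((ℓ : ℝ) * δ') * md)) := by ring
      rw [ed]; linarith only [k1, k2, hPd0]
    have i0 : 0 ≤ 24 * Real.exp R₀ * Real.exp R₀ * (((ℓ : ℝ) * (δ + δ')) * md) + 8 * Real.exp R₀ * ((ℓ : ℝ) * δd + 2 * ((ℓ : ℝ) * δ') * md) := by positivity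
    have i4 := mul_le_mul hs₀β i3 i0 hs₀0
    calc _ = 2 * (Fintype.card ι : ℝ) * (((ℓ : ℝ) * β) * (24 * Real.exp R₀ * Real.exp R₀ * (((ℓ : ℝ) * (δ + δ')) * md) + 8 * Real.exp R₀ * ((ℓ : ℝ) * δd + 2 * ((ℓ : ℝ) * δ') * md))) := by
          rw [← e]; ring
      _ ≤ 2 * (Fintype.card ι : ℝ) * (s₀ * (144 * Pd)) := mul_le_mul_of_nonneg_left i4 (by positivity)
      _ = 288 * (Fintype.card ι : ℝ) * s₀ * Pd := by ring
  -- sum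
  have hsum : 4 * s₀ * Pd + 80 * (Fintype.card ι : ℝ) * s₀ * Pd + (2 * P * Pd + 6 * P' * Pd + 18 * (Fintype.card ι : ℝ) * (P + P') * Pd
      + 158 * (Fintype.card ι : ℝ) * (P + P') * Pd) + 288 * (Fintype.card ι : ℝ) * s₀ * Pd ≤ 400 * (1 + (Fintype.card ι : ℝ)) * (P + P' + s₀) * Pd := by
    have e : 400 * (1 + (Fintype.card ι : ℝ)) * (P + P' + s₀) * Pd
        = 400 * (P * Pd) + 400 * (P' * Pd) + 400 * (s₀ * Pd)
          + 400 * ((Fintype.card ι : ℝ) * (P * Pd)) + 400 * ((Fintype.card ι : ℝ) * (P' * Pd)) + 400 * ((Fintype.card ι : ℝ) * (s₀ * Pd)) := by ring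
    rw [e]
    have n1 := mul_nonneg hι0 (mul_nonneg hP0 hPd0)
    have n2 := mul_nonneg hι0 (mul_nonneg hP'0 hPd0)
    have n3 := mul_nonneg hι0 (mul_nonneg hs₀0 hPd0)
    have n4 := mul_nonneg hP0 hPd0
    have n5 := mul_nonneg hP'0 hPd0
    have n6 := mul_nonneg hs₀0 hPd0
    have e2 : 4 * s₀ * Pd + 80 * (Fintype.card ι : ℝ) * s₀ * Pd + (2 * P * Pd + 6 * P' * Pd + 18 * (Fintype.card ι : ℝ) * (P + P') * Pd
        + 158 * (Fintype.card ι : ℝ) * (P + P') * Pd) + 288 * (Fintype.card ι : ℝ) * s₀ * Pd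
        = 2 * (P * Pd) + 6 * (P' * Pd) + 4 * (s₀ * Pd)
          + 176 * ((Fintype.card ι : ℝ) * (P * Pd)) + 176 * ((Fintype.card ι : ℝ) * (P' * Pd)) + 368 * ((Fintype.card ι : ℝ) * (s₀ * Pd)) := by ring
    rw [e2]
    linarith only [n1, n2, n3, n4, n5, n6]
  linarith only [T1, T2, T3, T4, T5, T6, T7, hsum]

end Summit.QuantumFields.YangMills.Theorems.Prop7ChartRemainderHNShape

end
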